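import Summits.BirchSwinnertonDyer.BirchSwinnertonDyer.Theorems.SignedLowerHalvesSmallImageLowerHalfBothSignsRttD2SeqSemilocData
import Summits.BirchSwinnertonDyer.BirchSwinnertonDyer.Theorems.SignedLowerHalvesSmallImageLowerHalfBothSignsRttD2SeqSemilocKrull
import Summits.BirchSwinnertonDyer.BirchSwinnertonDyer.Theorems.SignedLowerHalvesSmallImageLowerHalfBothSignsRttD2SeqSemilocExactCarrier
import Summits.BirchSwinnertonDyer.BirchSwinnertonDyer.Theorems.SignedLowerHalvesSmallImageLowerHalfBothSignsRttD2SeqJ3HPerf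
import Summits.BirchSwinnertonDyer.BirchSwinnertonDyer.Theorems.SignedLowerHalvesSmallImageLowerHalfBothSignsRttJunctionBinomial
import HarnessLib

/-!
# Route `SignedLowerHalves`, crux L `SmallImageLowerHalfBothSigns` (stmt-BirchSwinnertonDyer-23599), line `rtt_w3` v32 — stub S3β″ (`stub_junctionPT_ns`), input N5-(iii)
# (unramified generator), component C5: THE COEFFICIENT LEVEL `Maps(Γ_K ⧸ U_n, X_k)` AS A CYCLIC `Λ_𝒪`-MODULE GENERATED BY `b₀ = δ_1 ⊗ ζ₀`

WIDTH seat `bsd-line-slh-p3-w3` g27 under LEAD `cruxlead-stmt-BirchSwinnertonDyer-23599` g14 (cell `bsd-ssimc`); helper `--supports stmt-BirchSwinnertonDyer-23599`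
(plan `Lines/rtt_w3-DESIGN-N5iii-w3-g26.md` §2 C5). DEFINITIONS WITH BODIES (the `𝒪`-scalars `coindScalar`/`coindScalarRingHom`/`coindModuleO`, the right translation `coindR`,
`ψ = R_γ − 1` (`coindPsi`), the forced `Λ_𝒪`-structure `coindModuleΛ` of the coinduced coefficients — the twin of g25's `semilocLayerModuleΛ` one level BELOW cohomology) + THEOREMS;
no named fact, no instance, no `sorry`. HONEST FRAMING: finite-level module bookkeeping. With `Λ_𝒪 = 𝒪⟦T⟧` acting on `Maps(Γ_K ⧸ U_n, X_k)` by `C a ↦ a ⊗ id`, `T ↦ R_γ − 1`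
(Kaplansky §19, locally nilpotent): `(1+T)^j • f = R_γ^j f`, `R_γ^j δ_1 = δ_{[γ]^{-j}}`, and for `γ` with `κ γ` a unit and `X_k = 𝒪 ⊗ μ_{p^k}` (θ′ trivial on `N_P`, `N_P` fixing
`μ_{p^k}`) the module is CYCLIC, generated by `b₀ = δ_1 ⊗ (1 ⊗ ζ₀)`, and `(p^k, ω_n) ⊆ Ann(b₀)` (the reverse inclusion = Weierstrass division, next file). Nothing about S3β″, crux L or
BSD is proved; all remain OPEN and are proved for NO curve.
References: [Kaplansky1954] §19; [Lang1990] Ch. 5 §1; [SerreLocalFields1979] VII §5–§6; [NeukirchSchmidtWingberg2008] I §6, (7.2.6); [Washington1997] §13.2.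
-/

set_option autoImplicit false
set_option linter.dupNamespace false -- D-0017: single-problem summit, the namespace repeats the problem name by design
noncomputable section

open scoped Classical PowerSeries
open NumberField IsDedekindDomain Field CategoryTheory Function

namespace Summit.BirchSwinnertonDyer.BirchSwinnertonDyer.Theorems.SmallImageRttD2Seq

open Literature.NumberTheory.EllipticCurves Literature.NumberTheory.EllipticCurves.IwasawaDual Literature.NumberTheory.GaloisRepresentations
  Literature.NumberTheory.GaloisRepresentations.DiscreteGaloisModule
  Literature.NumberTheory.ComplexMultiplication.EllipticUnits Literature.NumberTheory.ComplexMultiplication.EllipticUnits.JohnsonLeungKings2011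
  Literature.Algebra.Module.LocallyNilpotent
  Summit.BirchSwinnertonDyer.BirchSwinnertonDyer.Theorems.SmallImageRttD2J1

section Coind

variable {K : Type} [Field K] {p : ℕ} [Fact p.Prime] (S : Set (PadicAlgCl p)) (κ : ZpExtension K p) (γ : absoluteGaloisGroup K)
  (θ' : absoluteGaloisGroup K →ₜ* (padicCoeffIntegers S)ˣ) (P : Set (HeightOneSpectrum (𝓞 K)))

/-! ## §1. `𝒪`-scalars, right translation, `ψ = R_γ − 1` -/

/-- **The `𝒪`-scalar `a ⊗ id` on `Maps(Γ_K ⧸ U_n, X_k)`** — the underlying additive map of `coindFinMap (coeffHomK (a ⊗ id))`, the morphism through which `semilocScalar a` is defined.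
[cite: JohnsonLeungKings2011, §4.1 Def. 4.1] -/
def coindScalar (n k : ℕ) (a : padicCoeffIntegers S) :
    coindFin.{0, 0} (coeffRepK S θ' P k).toTopRep (κ.layerSubgroup n) →+ coindFin.{0, 0} (coeffRepK S θ' P k).toTopRep (κ.layerSubgroup n) where
  toFun f := (coindFinMap (coeffHomK S θ' P (oMuScalar S (p ^ k) a) (oMuScalar_muTwistO S θ' k a)) (κ.layerSubgroup n)).hom f
  map_zero' := map_zero _
  map_add' := map_add _

/-- Values of `coindScalar`: `a ⊗ id` pointwise. [folklore] -/
theorem coindScalar_apply_coe (n k : ℕ) (a : padicCoeffIntegers S) (f : coindFin.{0, 0} (coeffRepK S θ' P k).toTopRep (κ.layerSubgroup n))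
    (y : absoluteGaloisGroup K ⧸ κ.layerSubgroup n) :
    ((coindScalar S κ θ' P n k a f y : (coeffRepK S θ' P k).toTopRep) : OMuCarrier K S (p ^ k)) =
      oMuScalar S (p ^ k) a ((f y : (coeffRepK S θ' P k).toTopRep) : OMuCarrier K S (p ^ k)) :=
  rfl

/-- `0 ⊗ id = 0` on `𝒪 ⊗ μ`. [folklore] -/
theorem oMuScalar_zero_apply (n : ℕ) (x : OMuCarrier K S n) : oMuScalar S n 0 x = 0 := by
  have h := oMuScalar_add S n 0 0 x
  rw [add_zero] at h
  exact (left_eq_add.mp h)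

/-- **The `𝒪`-action on `Maps(Γ_K ⧸ U_n, X_k)` as a ring homomorphism `𝒪 → End`.** [cite: JohnsonLeungKings2011, §4.1 Def. 4.1] -/
def coindScalarRingHom (n k : ℕ) : padicCoeffIntegers S →+* AddMonoid.End (coindFin.{0, 0} (coeffRepK S θ' P k).toTopRep (κ.layerSubgroup n)) where
  toFun a := coindScalar S κ θ' P n k a
  map_one' := AddMonoidHom.ext fun _ ↦ funext fun _ ↦ Subtype.ext (oMuScalar_one S (p ^ k) _)
  map_mul' a b := AddMonoidHom.ext fun _ ↦ funext fun _ ↦ Subtype.ext (oMuScalar_mul S (p ^ k) a b _)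
  map_zero' := AddMonoidHom.ext fun _ ↦ funext fun _ ↦ Subtype.ext (oMuScalar_zero_apply S (p ^ k) _)
  map_add' a b := AddMonoidHom.ext fun _ ↦ funext fun _ ↦ Subtype.ext (oMuScalar_add S (p ^ k) a b _)

/-- **The `𝒪`-module structure of `Maps(Γ_K ⧸ U_n, X_k)`** (activate with `letI`). [cite: JohnsonLeungKings2011, §4.1 Def. 4.1] -/
@[reducible] def coindModuleO (n k : ℕ) : Module (padicCoeffIntegers S) (coindFin.{0, 0} (coeffRepK S θ' P k).toTopRep (κ.layerSubgroup n)) :=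
  Module.compHom _ (coindScalarRingHom S κ θ' P n k)

/-- The `𝒪`-action is `a • f = coindScalar a f`. [folklore] -/
theorem coindModuleO_smul (n k : ℕ) (a : padicCoeffIntegers S) (f : coindFin.{0, 0} (coeffRepK S θ' P k).toTopRep (κ.layerSubgroup n)) :
    (letI := coindModuleO S κ θ' P n k; a • f) = coindScalar S κ θ' P n k a f := rfl

/-- **Right translation `R_g` on `Maps(Γ_K ⧸ U_n, X_k)`** (`(R_g f)(y) = f(y·g)`) — the underlying additive map of the tree's `rTransHom`, through which `semilocConj g` is defined.
[cite: SerreLocalFields1979, VII §5] -/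
def coindR (n k : ℕ) (g : absoluteGaloisGroup K) :
    coindFin.{0, 0} (coeffRepK S θ' P k).toTopRep (κ.layerSubgroup n) →+ coindFin.{0, 0} (coeffRepK S θ' P k).toTopRep (κ.layerSubgroup n) where
  toFun f := (rTransHom (coeffRepK S θ' P k).toTopRep (κ.layerSubgroup n) (g : absoluteGaloisGroup K ⧸ κ.layerSubgroup n)).hom f
  map_zero' := map_zero _
  map_add' := map_add _

/-- Values of `coindR`: `(R_g f)(y) = f(y·g)`. [folklore] -/
theorem coindR_apply (n k : ℕ) (g : absoluteGaloisGroup K) (f : coindFin.{0, 0} (coeffRepK S θ' P k).toTopRep (κ.layerSubgroup n)) (y : absoluteGaloisGroup K ⧸ κ.layerSubgroup n) :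
    coindR S κ θ' P n k g f y = f (y * (g : absoluteGaloisGroup K ⧸ κ.layerSubgroup n)) :=
  rfl

/-- Right translation as an element of `AddMonoid.End`. [folklore] -/
abbrev coindREnd (n k : ℕ) (g : absoluteGaloisGroup K) : AddMonoid.End (coindFin.{0, 0} (coeffRepK S θ' P k).toTopRep (κ.layerSubgroup n)) :=
  coindR S κ θ' P n k g

/-- Powers: `R_g^m = R_{g^m}`. [folklore] -/
theorem coindR_pow_apply (n k : ℕ) (g : absoluteGaloisGroup K) (m : ℕ) (f : coindFin.{0, 0} (coeffRepK S θ' P k).toTopRep (κ.layerSubgroup n)) :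
    (coindREnd S κ θ' P n k g ^ m) f = coindR S κ θ' P n k (g ^ m) f := by
  induction m generalizing f with
  | zero =>
    rw [pow_zero, pow_zero, AddMonoid.End.one_apply]
    exact funext fun y ↦ by rw [coindR_apply, QuotientGroup.mk_one, mul_one]
  | succ m ih =>
    rw [pow_succ, AddMonoid.End.coe_mul, Function.comp_apply, ih]
    refine funext fun y ↦ ?_
    change coindR S κ θ' P n k (g ^ m) (coindR S κ θ' P n k g f) y = _
    rw [coindR_apply, coindR_apply, coindR_apply, pow_succ, QuotientGroup.mk_mul, mul_assoc]

/-- **Elements of `U_n` translate trivially.** [cite: SerreLocalFields1979, VII §5 Prop. 3] -/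
theorem coindR_eq_self_of_mem (n k : ℕ) {g : absoluteGaloisGroup K} (hg : g ∈ κ.layerSubgroup n) (f : coindFin.{0, 0} (coeffRepK S θ' P k).toTopRep (κ.layerSubgroup n)) :
    coindR S κ θ' P n k g f = f :=
  funext fun y ↦ by rw [coindR_apply, (QuotientGroup.eq_one_iff g).mpr hg, mul_one]

/-- **Unipotence of echelon `pⁿ`: `R_γ^{pⁿ} = id`.** [cite: Lang1990, Ch. 5 §1] -/
theorem coindR_pow_index_apply (n k : ℕ) (f : coindFin.{0, 0} (coeffRepK S θ' P k).toTopRep (κ.layerSubgroup n)) :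
    (coindREnd S κ θ' P n k γ ^ p ^ n) f = f := by
  rw [coindR_pow_apply]
  refine coindR_eq_self_of_mem S κ θ' P n k ?_ f
  rw [← κ.index_layerSubgroup n]
  exact Subgroup.pow_index_mem (κ.layerSubgroup n) γ

/-- `R_g` commutes with the `𝒪`-scalars. [folklore] -/
theorem coindScalar_coindR (n k : ℕ) (a : padicCoeffIntegers S) (g : absoluteGaloisGroup K) (f : coindFin.{0, 0} (coeffRepK S θ' P k).toTopRep (κ.layerSubgroup n)) :
    coindScalar S κ θ' P n k a (coindR S κ θ' P n k g f) = coindR S κ θ' P n k g (coindScalar S κ θ' P n k a f) :=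
  rfl

/-- **Uniform `p^k`-torsion** of `Maps(Γ_K ⧸ U_n, X_k)`. [cite: Kato2004Asterisque, §8.2 (p. 180)] -/
theorem coind_torsion (n k : ℕ) (f : coindFin.{0, 0} (coeffRepK S θ' P k).toTopRep (κ.layerSubgroup n)) : p ^ k • f = 0 := by
  refine funext fun y ↦ ?_
  change p ^ k • f y = 0
  rw [← natCast_zsmul]
  exact_mod_cast coeffGSO_torsion S P θ' k (f y)

/-- **The `𝒪`-LINEAR operator `ψ = R_γ − 1`.** [cite: JohnsonLeungKings2011, §4.2] [cite: SerreLocalFields1979, VII §5] -/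
def coindPsi (n k : ℕ) :
    letI := coindModuleO S κ θ' P n k
    Module.End (padicCoeffIntegers S) (coindFin.{0, 0} (coeffRepK S θ' P k).toTopRep (κ.layerSubgroup n)) := by
  letI := coindModuleO S κ θ' P n k
  exact
    { toFun := fun f ↦ coindR S κ θ' P n k γ f - f
      map_add' := fun x y ↦ by rw [map_add]; abel
      map_smul' := fun a f ↦ by
        change coindR S κ θ' P n k γ (coindScalar S κ θ' P n k a f) - coindScalar S κ θ' P n k a f = coindScalar S κ θ' P n k a (coindR S κ θ' P n k γ f - f)
        rw [map_sub, coindScalar_coindR] }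

/-- Unfolding `coindPsi`. [folklore] -/
theorem coindPsi_apply (n k : ℕ) (f : coindFin.{0, 0} (coeffRepK S θ' P k).toTopRep (κ.layerSubgroup n)) :
    (letI := coindModuleO S κ θ' P n k; coindPsi S κ γ θ' P n k f) = coindR S κ θ' P n k γ f - f := rfl

set_option maxHeartbeats 1600000 in
/-- Powers of `ψ` agree with powers of `R_γ − 1` in `AddMonoid.End`. [folklore] -/
theorem coindPsi_pow_apply (n k : ℕ) (m : ℕ) (f : coindFin.{0, 0} (coeffRepK S θ' P k).toTopRep (κ.layerSubgroup n)) :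
    (letI := coindModuleO S κ θ' P n k; (coindPsi S κ γ θ' P n k ^ m) f) = ((coindREnd S κ θ' P n k γ - 1) ^ m) f := by
  letI := coindModuleO S κ θ' P n k
  induction m generalizing f with
  | zero => rfl
  | succ m ih =>
    rw [pow_succ, pow_succ, Module.End.mul_apply, AddMonoid.End.coe_mul, Function.comp_apply]
    rw [coindPsi_apply]
    rw [ih]
    rfl

/-- **`ψ = R_γ − 1` is locally nilpotent** (`p^k`-torsion + `R_γ^{pⁿ} = 1`). [cite: Lang1990, Ch. 5 §1] -/
theorem coindPsi_locallyNilpotent (n k : ℕ) (f : coindFin.{0, 0} (coeffRepK S θ' P k).toTopRep (κ.layerSubgroup n)) :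
    letI := coindModuleO S κ θ' P n k
    ∃ m : ℕ, (coindPsi S κ γ θ' P n k ^ m) f = 0 := by
  have h := exists_pow_twistEnd_sub_one_apply_eq_zero (p := p) (n := 1) (e := k) (m := n) (coindREnd S κ θ' P n k γ)
    (fun a ↦ coindR_pow_index_apply S κ γ θ' P n k a) (fun a ↦ coind_torsion S κ θ' P n k a) (by rw [Nat.cast_one, sub_self]; exact dvd_zero _) f
  rw [twistEnd_one] at h
  obtain ⟨m, hm⟩ := h
  exact ⟨m, by rw [coindPsi_pow_apply, hm]⟩

/-! ## §2. The forced `Λ_𝒪`-structure -/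

/-- **Existence of the `Λ_𝒪 = 𝒪⟦T⟧`-structure on `Maps(Γ_K ⧸ U_n, X_k)`**: `X ↦ ψ`, `C a ↦ a ⊗ id`. [cite: Kaplansky1954, §19] [cite: Lang1990, Ch. 5 §1] -/
theorem exists_coindModuleΛ (n k : ℕ) :
    letI := coindModuleO S κ θ' P n k
    ∃ (_ : Module (IwasawaAlgebraO S) (coindFin.{0, 0} (coeffRepK S θ' P k).toTopRep (κ.layerSubgroup n))),
      (∀ (a : padicCoeffIntegers S) (v : coindFin.{0, 0} (coeffRepK S θ' P k).toTopRep (κ.layerSubgroup n)), (PowerSeries.C a : IwasawaAlgebraO S) • v = a • v) ∧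
        ∀ v : coindFin.{0, 0} (coeffRepK S θ' P k).toTopRep (κ.layerSubgroup n), (PowerSeries.X : IwasawaAlgebraO S) • v = coindPsi S κ γ θ' P n k v := by
  letI := coindModuleO S κ θ' P n k
  exact exists_module_powerSeries (coindPsi S κ γ θ' P n k) (coindPsi_locallyNilpotent S κ γ θ' P n k)

/-- ★ **The `Λ_𝒪`-structure of `Maps(Γ_K ⧸ U_n, X_k)`** (a choice from `exists_coindModuleΛ`; its action is forced; activate with `letI`). [cite: Lang1990, Ch. 5 §1] -/
@[reducible] def coindModuleΛ (n k : ℕ) : Module (IwasawaAlgebraO S) (coindFin.{0, 0} (coeffRepK S θ' P k).toTopRep (κ.layerSubgroup n)) :=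
  (exists_coindModuleΛ S κ γ θ' P n k).choose

/-- The defining identities: `C a ↦ a ⊗ id`, `X ↦ ψ`. [cite: Lang1990, Ch. 5 §1] -/
theorem coindModuleΛ_spec (n k : ℕ) :
    letI := coindModuleO S κ θ' P n k
    letI := coindModuleΛ S κ γ θ' P n k
    (∀ (a : padicCoeffIntegers S) (v : coindFin.{0, 0} (coeffRepK S θ' P k).toTopRep (κ.layerSubgroup n)), (PowerSeries.C a : IwasawaAlgebraO S) • v = a • v) ∧
      ∀ v : coindFin.{0, 0} (coeffRepK S θ' P k).toTopRep (κ.layerSubgroup n), (PowerSeries.X : IwasawaAlgebraO S) • v = coindPsi S κ γ θ' P n k v :=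
  (exists_coindModuleΛ S κ γ θ' P n k).choose_spec

set_option maxHeartbeats 1600000 in
/-- **`(1+T)^j` acts as `R_γ^j = R_{γ^j}`.** [cite: JohnsonLeungKings2011, §4.2] [cite: Lang1990, Ch. 5 §1] -/
theorem one_add_X_pow_smul (n k j : ℕ) (f : coindFin.{0, 0} (coeffRepK S θ' P k).toTopRep (κ.layerSubgroup n)) :
    (letI := coindModuleΛ S κ γ θ' P n k; ((1 + PowerSeries.X : IwasawaAlgebraO S) ^ j) • f) = coindR S κ θ' P n k (γ ^ j) f := by
  letI := coindModuleO S κ θ' P n k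
  letI := coindModuleΛ S κ γ θ' P n k
  rw [← coindR_pow_apply]
  induction j generalizing f with
  | zero => rw [pow_zero, one_smul, pow_zero, AddMonoid.End.one_apply]
  | succ j ih =>
    rw [pow_succ, mul_smul]
    rw [ih]
    rw [pow_succ, AddMonoid.End.coe_mul, Function.comp_apply, add_smul, one_smul]
    rw [(coindModuleΛ_spec S κ γ θ' P n k).2]
    rw [coindPsi_apply, add_sub_cancel]
    rfl

/-- **`ω_n = (1+T)^{pⁿ} − 1` kills `Maps(Γ_K ⧸ U_n, X_k)`.** [cite: Lang1990, Ch. 5 §1] [cite: Washington1997, §7.1] -/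
theorem omegaT_smul (n k : ℕ) (f : coindFin.{0, 0} (coeffRepK S θ' P k).toTopRep (κ.layerSubgroup n)) :
    (letI := coindModuleΛ S κ γ θ' P n k; (omegaT S n) • f) = 0 := by
  letI := coindModuleΛ S κ γ θ' P n k
  rw [omegaT, sub_smul, one_smul, one_add_X_pow_smul, ← coindR_pow_apply, coindR_pow_index_apply, sub_self]

/-- **`C(p^k)` kills `Maps(Γ_K ⧸ U_n, X_k)`.** [cite: Kato2004Asterisque, §8.2 (p. 180)] -/
theorem C_pow_smul (n k : ℕ) (f : coindFin.{0, 0} (coeffRepK S θ' P k).toTopRep (κ.layerSubgroup n)) :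
    (letI := coindModuleΛ S κ γ θ' P n k; (PowerSeries.C (((p : ℕ) : padicCoeffIntegers S) ^ k) : IwasawaAlgebraO S) • f) = 0 := by
  letI := coindModuleO S κ θ' P n k
  letI := coindModuleΛ S κ γ θ' P n k
  have h : coindScalarRingHom S κ θ' P n k (((p : ℕ) : padicCoeffIntegers S) ^ k) = ((p ^ k : ℕ) : AddMonoid.End (coindFin.{0, 0} (coeffRepK S θ' P k).toTopRep (κ.layerSubgroup n))) := by
    rw [map_pow, map_natCast, Nat.cast_pow]
  rw [(coindModuleΛ_spec S κ γ θ' P n k).1, coindModuleO_smul]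
  change coindScalarRingHom S κ θ' P n k (((p : ℕ) : padicCoeffIntegers S) ^ k) f = 0
  rw [h, AddMonoid.End.natCast_apply, coind_torsion]

/-- A general power series acts as its truncation at any exponent killing the vector (Kaplansky: the action is forced). [cite: Kaplansky1954, §19 Thm. 31] -/
theorem smul_eq_aeval_trunc (n k : ℕ) {m : ℕ} {f : coindFin.{0, 0} (coeffRepK S θ' P k).toTopRep (κ.layerSubgroup n)}
    (hm : letI := coindModuleO S κ θ' P n k; (coindPsi S κ γ θ' P n k ^ m) f = 0) (g : IwasawaAlgebraO S) :
    (letI := coindModuleΛ S κ γ θ' P n k; g • f) = (letI := coindModuleO S κ θ' P n k; Polynomial.aeval (coindPsi S κ γ θ' P n k) (PowerSeries.trunc m g) f) := by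
  letI := coindModuleO S κ θ' P n k
  letI := coindModuleΛ S κ γ θ' P n k
  exact smul_eq_aeval_trunc_apply (coindModuleΛ_spec S κ γ θ' P n k).1 (coindModuleΛ_spec S κ γ θ' P n k).2 hm g

/-! ## §3. The elements `δ_y ⊗ ξ` and the generator `b₀ = δ_1 ⊗ ξ₀` -/

/-- **`δ_y ⊗ ξ ∈ Maps(Γ_K ⧸ U_n, X_k)`**: the function supported at the coset `y` with value `ξ`. [cite: SerreLocalFields1979, VII §6] -/
abbrev coindSingle (n k : ℕ) (y : absoluteGaloisGroup K ⧸ κ.layerSubgroup n) (ξ : (coeffRepK S θ' P k).toTopRep) :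
    coindFin.{0, 0} (coeffRepK S θ' P k).toTopRep (κ.layerSubgroup n) :=
  Pi.single (M := fun _ : absoluteGaloisGroup K ⧸ κ.layerSubgroup n ↦ ↥((coeffRepK S θ' P k).toTopRep)) y ξ

/-- `(δ_y ⊗ ξ)(y) = ξ`. [folklore] -/
theorem coindSingle_apply_self (n k : ℕ) (y : absoluteGaloisGroup K ⧸ κ.layerSubgroup n) (ξ : (coeffRepK S θ' P k).toTopRep) :
    coindSingle S κ θ' P n k y ξ y = ξ :=
  Pi.single_eq_same (M := fun _ : absoluteGaloisGroup K ⧸ κ.layerSubgroup n ↦ ↥((coeffRepK S θ' P k).toTopRep)) y ξ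

/-- `(δ_y ⊗ ξ)(z) = 0` for `z ≠ y`. [folklore] -/
theorem coindSingle_apply_of_ne (n k : ℕ) {y z : absoluteGaloisGroup K ⧸ κ.layerSubgroup n} (h : z ≠ y) (ξ : (coeffRepK S θ' P k).toTopRep) :
    coindSingle S κ θ' P n k y ξ z = 0 :=
  Pi.single_eq_of_ne (M := fun _ : absoluteGaloisGroup K ⧸ κ.layerSubgroup n ↦ ↥((coeffRepK S θ' P k).toTopRep)) h ξ

/-- `f = Σ_y δ_y ⊗ f(y)`. [folklore] -/
theorem sum_coindSingle (n k : ℕ) (f : coindFin.{0, 0} (coeffRepK S θ' P k).toTopRep (κ.layerSubgroup n)) :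
    letI := layerQuotFintype κ n
    ∑ y, coindSingle S κ θ' P n k y (f y) = f := by
  letI := layerQuotFintype κ n
  exact Finset.univ_sum_single (M := fun _ : absoluteGaloisGroup K ⧸ κ.layerSubgroup n ↦ ↥((coeffRepK S θ' P k).toTopRep)) f

/-- **`R_g (δ_y ⊗ ξ) = δ_{y·ḡ⁻¹} ⊗ ξ`.** [cite: SerreLocalFields1979, VII §5] -/
theorem coindR_single (n k : ℕ) (g : absoluteGaloisGroup K) (y : absoluteGaloisGroup K ⧸ κ.layerSubgroup n) (ξ : (coeffRepK S θ' P k).toTopRep) :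
    coindR S κ θ' P n k g (coindSingle S κ θ' P n k y ξ) = coindSingle S κ θ' P n k (y * (g : absoluteGaloisGroup K ⧸ κ.layerSubgroup n)⁻¹) ξ := by
  refine funext fun z ↦ ?_
  rw [coindR_apply]
  by_cases hz : z = y * (g : absoluteGaloisGroup K ⧸ κ.layerSubgroup n)⁻¹
  · subst hz
    rw [coindSingle_apply_self, inv_mul_cancel_right, coindSingle_apply_self]
  · rw [coindSingle_apply_of_ne S κ θ' P n k hz, coindSingle_apply_of_ne]
    intro h
    exact hz (by rw [← h, mul_inv_cancel_right])

/-- **`a • (δ_y ⊗ ξ) = δ_y ⊗ (a ⊗ id) ξ`.** [cite: JohnsonLeungKings2011, §4.1 Def. 4.1] -/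
theorem coindScalar_single (n k : ℕ) (a : padicCoeffIntegers S) (y : absoluteGaloisGroup K ⧸ κ.layerSubgroup n) (ξ : (coeffRepK S θ' P k).toTopRep) :
    coindScalar S κ θ' P n k a (coindSingle S κ θ' P n k y ξ) =
      coindSingle S κ θ' P n k y (coeffMapO S P θ' (oMuScalar S (p ^ k) a) (oMuScalar_muTwistO S θ' k a) ξ) := by
  refine funext fun z ↦ ?_
  change (coeffHomK S θ' P (oMuScalar S (p ^ k) a) (oMuScalar_muTwistO S θ' k a)).hom (coindSingle S κ θ' P n k y ξ z) = _
  by_cases hz : z = y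
  · subst hz
    rw [coindSingle_apply_self, coindSingle_apply_self]
    rfl
  · rw [coindSingle_apply_of_ne S κ θ' P n k hz, coindSingle_apply_of_ne S κ θ' P n k hz, map_zero]

/-- **`(C a · (1+T)^j) • (δ_1 ⊗ ξ) = δ_{[γ^j]⁻¹} ⊗ (a ⊗ id) ξ`** — the monomials of `Λ_𝒪/(p^k, ω_n)` hit every `δ_y ⊗ a ξ`. [cite: Lang1990, Ch. 5 §1] [cite: SerreLocalFields1979, VII §6] -/
theorem C_mul_one_add_X_pow_smul_single_one (n k j : ℕ) (a : padicCoeffIntegers S) (ξ : (coeffRepK S θ' P k).toTopRep) :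
    (letI := coindModuleΛ S κ γ θ' P n k; (PowerSeries.C a * (1 + PowerSeries.X : IwasawaAlgebraO S) ^ j) • coindSingle S κ θ' P n k 1 ξ) =
      coindSingle S κ θ' P n k (((γ ^ j : absoluteGaloisGroup K) : absoluteGaloisGroup K ⧸ κ.layerSubgroup n)⁻¹)
        (coeffMapO S P θ' (oMuScalar S (p ^ k) a) (oMuScalar_muTwistO S θ' k a) ξ) := by
  letI := coindModuleO S κ θ' P n k
  letI := coindModuleΛ S κ γ θ' P n k
  rw [mul_smul, one_add_X_pow_smul, coindR_single, one_mul, (coindModuleΛ_spec S κ γ θ' P n k).1, coindModuleO_smul, coindScalar_single]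

/-- **Every coset of `Γ_K ⧸ U_n` is `[γ^j]⁻¹` for some `j`** when `κ γ` is a unit of `ℤ_p` (the image of `γ` generates the cyclic group `Γ_K ⧸ U_n`). [cite: Washington1997, §13.1–13.2] -/
theorem exists_eq_mk_pow_inv (n : ℕ) {a : ℤ_[p]ˣ} (hγ : (κ γ).toAdd = a) (y : absoluteGaloisGroup K ⧸ κ.layerSubgroup n) :
    ∃ j : ℕ, y = (((γ ^ j : absoluteGaloisGroup K) : absoluteGaloisGroup K ⧸ κ.layerSubgroup n))⁻¹ := by
  induction y using QuotientGroup.induction_on with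
  | H g =>
    refine ⟨(PadicInt.toZModPow n (((a⁻¹ : ℤ_[p]ˣ) : ℤ_[p]) * (κ g⁻¹).toAdd)).val, ?_⟩
    have h := SmallImageRttJunctionLocal.pow_toZModPow_val_mul_inv_mem_layerSubgroup (κ := κ) (γ := γ) hγ g⁻¹ n
    rw [inv_inv] at h
    rw [eq_inv_iff_mul_eq_one, ← QuotientGroup.mk_mul, QuotientGroup.eq_one_iff]
    -- `g γ^m ∈ U_n` from `γ^m g ∈ U_n` (normal subgroup, conjugate by `g`)
    have h2 := (κ.layerSubgroup_normal n).conj_mem _ h g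
    simpa only [← mul_assoc, mul_inv_cancel_right] using h2

/-- ★ **`Maps(Γ_K ⧸ U_n, X_k)` is CYCLIC over `Λ_𝒪`, generated by `b₀ = δ_1 ⊗ (1 ⊗ ζ₀)`**, when `κ γ` is a unit, `θ′` is trivial on `N_P` and `N_P` fixes `μ_{p^k}` (so `X_k = 𝒪 ⊗ μ_{p^k} = 𝒪·(1⊗ζ₀)`
for a generator `ζ₀` of `μ_{p^k}`): `f = Σ_y δ_y ⊗ f(y)`, `f(y) = a_y ⊗ ζ₀`, `δ_y ⊗ a_y(1⊗ζ₀) = (C a_y (1+T)^{j_y}) • b₀`. [cite: Lang1990, Ch. 5 §1] [cite: NeukirchSchmidtWingberg2008, (7.2.6)]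
[cite: SerreLocalFields1979, VII §6] -/
theorem exists_smul_single_one_eq (n k : ℕ) {a : ℤ_[p]ˣ} (hγ : (κ γ).toAdd = a) (hθN : ∀ g ∈ ramificationSubgroup K P, θ' g = 1)
    (hμN : ∀ g ∈ ramificationSubgroup K P, ∀ ζ : MuCarrier K (p ^ k), mu K (p ^ k) g ζ = ζ)
    {ζ₀ : MuCarrier K (p ^ k)} (hζ₀ : ∀ ζ : MuCarrier K (p ^ k), ∃ m : ℤ, ζ = m • ζ₀) (f : coindFin.{0, 0} (coeffRepK S θ' P k).toTopRep (κ.layerSubgroup n)) :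
    ∃ r : IwasawaAlgebraO S, (letI := coindModuleΛ S κ γ θ' P n k;
      r • coindSingle S κ θ' P n k 1 ⟨OMuCarrier.tmul 1 ζ₀, mem_invariants_muTwistO_of_forall S θ' P k hθN hμN _⟩) = f := by
  letI := layerQuotFintype κ n
  letI := coindModuleΛ S κ γ θ' P n k
  -- each `δ_y ⊗ f(y)` is a monomial multiple of `b₀`
  have hsingle : ∀ y : absoluteGaloisGroup K ⧸ κ.layerSubgroup n, ∃ r : IwasawaAlgebraO S,
      r • coindSingle S κ θ' P n k 1 ⟨OMuCarrier.tmul 1 ζ₀, mem_invariants_muTwistO_of_forall S θ' P k hθN hμN _⟩ = coindSingle S κ θ' P n k y (f y) := by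
    intro y
    obtain ⟨j, rfl⟩ := exists_eq_mk_pow_inv κ γ n hγ y
    obtain ⟨c, hc⟩ := exists_eq_tmul_of_generator K S k hζ₀ ((f _ : (coeffRepK S θ' P k).toTopRep) : OMuCarrier K S (p ^ k))
    refine ⟨PowerSeries.C c * (1 + PowerSeries.X) ^ j, ?_⟩
    rw [C_mul_one_add_X_pow_smul_single_one]
    congr 1
    refine Subtype.ext ?_
    change oMuScalar S (p ^ k) c (OMuCarrier.tmul 1 ζ₀) = _
    rw [oMuScalar_tmul, mul_one, ← hc]
  choose r hr using hsingle
  refine ⟨∑ y, r y, ?_⟩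
  rw [Finset.sum_smul]
  simp only [hr]
  exact sum_coindSingle S κ θ' P n k f

end Coind

end Summit.BirchSwinnertonDyer.BirchSwinnertonDyer.Theorems.SmallImageRttD2Seq

end
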